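import Literature.AlgebraicGeometry.AbelianSchemes.MumfordQuotientPoincare
import Literature.AlgebraicGeometry.AbelianSchemes.MumfordBundleEquivariantStructure
import Literature.AlgebraicGeometry.AbelianSchemes.AbelianSchemeConstSubgroupQuotientPoints
import Literature.AlgebraicGeometry.AbelianSchemes.AbelianSchemeConstSubgroupQuotientGroupLaw
import Literature.AlgebraicGeometry.AbelianSchemes.AbelianSchemeConstSubgroupQuotientSmooth
import Literature.AlgebraicGeometry.AbelianSchemes.AbelianSchemeConstSubgroupQuotientEtale
import Literature.AlgebraicGeometry.AbelianSchemes.AbelianSchemeOverHomNoetherianAnyBase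
import Literature.AlgebraicGeometry.Morphisms.FinsetInAffineOpenOfProjective
import Literature.AlgebraicGeometry.Modules.UnitCocyclePresented
import HarnessLib

/-!
# Mumford's construction of the dual pair over an affine base with CONSTANT `K(L)`: the quotient `A⁄K`, the homomorphism
# `π : A → A⁄K` with kernel `K`, and the descended Poincaré sheaf — everything but universality

Layer `Literature/AlgebraicGeometry/AbelianSchemes`, namespace `Literature.AlgebraicGeometry.AbelianSchemes.AbelianSchemeOver`.
THEOREMS ONLY (no definition, no named fact, no instance, no notation, no `sorry`; net Literature debt 0).

[MumfordAV1970] §13, Theorem p. 125 (construction half): for an abelian variety `X` and an ample `L`, «`X̂ := X⁄K(L)`, `π : X → X̂`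
the quotient map (a separable isogeny with kernel `K(L)`), and the Poincaré bundle `P` on `X × X̂` is the descent of
`Λ(L) = m^*L ⊗ p₁^*L⁻¹ ⊗ p₂^*L⁻¹` along `1 × π`; `P|_{{0} × X̂}` is trivial and `P|_{X × {π x}} ≅ T_x^*L ⊗ L⁻¹ ∈ Pic⁰(X)`»;
§12 Thm. 1 p. 112 (descent along a free quotient); §7 Thm. 4 p. 72 and Remark p. 69 (quotients by finite groups, quasi-projectivity).
[MumfordFogartyKirwan1994] Ch. 6 §1 Cor. 6.8 (p. 118), §2 (p. 121).  THIS FILE assembles the construction RELATIVE to an AFFINE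
locally Noetherian base `S′` of characteristic `0` for an abelian scheme `A′ → S′` that is PROJECTIVE, a rigidified rank-one `L′`,
and a finite group `K′ ≤ A′(S′)` of sections WHICH IS the constant group scheme `K(L′)` (the étale-local situation produced from
`K(L)` finite étale by a splitting cover of the base) — entirely from ★∕seed capital:

* §1 **`exists_quotient_poincare_of_constant_sections`** — there are an abelian scheme `Â′ := A′⁄K′` (★ `quotientBy`, its
  four raw hypotheses DISCHARGED: stable affine cover from projectivity — `Morphisms.exists_isAffineOpen_forall_mem_of_isProjective`
  + ★ `translationActionOver_hcov_of_forall_finset` —, group law ★ `exists_grpObj_isMonHom_quotientMk`, smoothness ★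
  `smooth_quotientOver_hom_of_hom_spec` (char `0`), connected fibres ★ `geometricallyConnected_quotientOver_hom`; freeness from the
  injectivity of `K′` on geometric fibres, ★ `forall_comp_translation_ne_of_forall_restrict_ne`), the quotient HOMOMORPHISM
  `π : A′ → Â′` (★ `isMonHom_quotientMk`), finite étale surjective (★), with KERNEL `K′` on ALL `T`-points
  (`comp_quotientMk_eq_one_iff_exists_openCover`), and a module `𝒫′` on `A′ ×_{S′} Â′` with (F1) rank one, (F2) rigidified along
  `ε × 1`, (F3) fibrewise in `Pic⁰`, (F4) the SOCKET `(1 × π)^*𝒫′ ≅ Λ(L′)` (`MumfordQuotientPoincare.exists_rigidified_descent_mumfordBundle`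
  fed with the normalised `K′`-linearisation `MumfordBundleEquivariantStructure.nonempty_equivariantStructure_mumfordBundle`), and
  (F5) every finite set of points of `Â′` in an affine open (`exists_isAffineOpen_forall_mem_quotientOver`).
* §2 **`exists_quotient_poincare_of_constant_kOfL_baseChange`** — the same for `A′ := A ×_{Spec R} S′`, `L′ := L|_{A′}` with `L`
  rigidified on `A` and `K(L′)` given as the constant functor on `K′` (the functor-of-points clause of the F-3 (M) child line,
  letter (Mb)): the rigidification and the `K′ ⊆ K(L′)(S′)` clause are derived, and the kernel clause is returned in `K(L′)` form.
  This is the letter `stub_F3Mb` of `Cruxes/HDel/Lines/F3DualAbelianSchemeM` up to the universe and the name of the base field map.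

Cell `hodgecm-mathlib` (D-0151), FLOOR 0 programme P1, F-3 (M) child line (pair of record parent ed. 1.1 506102d4 + child ed. 3
a2099c1a), hand of record (Mb) = B-p16 (g18); census `B-provers/B-p16/g18/CENSUS-F3Mb-ConstantKQuotientPoincare.B-p16g18.md`.
Count-neutral; HC_CM is proved only modulo the 7 printed citations until rung 0 closes; nothing here is about HC.

Mathlib searched (pin): `LocallyOfFiniteType.isLocallyNoetherian`, `Over.tensorUnit_hom`, `Category.comp_id`; Mathlib has no
abelian schemes.

## References
* [MumfordAV1970] D. Mumford, *Abelian Varieties* (1970), §7 (Thm. p. 66, Remark p. 69, Thm. 4 p. 72), §12 Thm. 1 (p. 112),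
  §13 (Thm. p. 125 and its proof).
* [MumfordFogartyKirwan1994] D. Mumford, J. Fogarty, F. Kirwan, *GIT* 3rd ed. (1994), Ch. 6 §1 Cor. 6.8 (p. 118), §2 (p. 121).
* [MilneAV2008] J. S. Milne, *Abelian Varieties* (v2.00, 2008), I §8 pp. 36–37 and p. 40.
-/

set_option autoImplicit false

noncomputable section

-- `Scheme.Modules` / `SheafOfModules` are not reducible; `(A.quotientBy …).X = A.quotientOver …` holds by `rfl` only.
set_option backward.isDefEq.respectTransparency false

universe u

open CategoryTheory CategoryTheory.Limits AlgebraicGeometry MonoidalCategory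
open scoped MonObj

namespace Literature.AlgebraicGeometry.AbelianSchemes

open Literature.AlgebraicGeometry.RelativeSpec Literature.AlgebraicGeometry.Modules
  Literature.AlgebraicGeometry.Motives Literature.AlgebraicGeometry.AbelianVarieties

namespace AbelianSchemeOver

/-! ## §1 The construction over an affine base for a constant `K′ ⊆ K(L′)(S′)` -/

/-- **MUMFORD'S CONSTRUCTION OF `(A′⁄K′, π, 𝒫′)` OVER AN AFFINE BASE, CONSTANT `K′`** ([MumfordAV1970] §13 Theorem p. 125,
construction half; [MumfordFogartyKirwan1994] Cor. 6.8 ∕ §2 p. 121).  Let `S′` be an affine locally Noetherian scheme over a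
field of characteristic `0`, `A′ → S′` a PROJECTIVE abelian scheme, `L′` a rank-one module on `A′` rigidified along the unit
section, and `K′ ≤ A′(S′)` a finite group of sections, pairwise distinct on every geometric fibre, with `K′ ⊆ K(L′)(S′)`.  Then
there are an abelian scheme `Â′` over `S′`, a HOMOMORPHISM `π : A′ → Â′`, finite étale surjective, whose kernel on every
`T`-valued point is «locally a section of `K′`», and a module `𝒫′` on `A′ ×_{S′} Â′` of rank one, rigidified along `ε × 1`,
fibrewise in `Pic⁰`, with `(1 × π)^*𝒫′ ≅ Λ(L′)`, such that every finite set of points of `Â′` lies in an affine open.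
(`Â′ = A′⁄K′` by translations; `𝒫′` = the rigidified descent of `Λ(L′)` along `1 × π`.) [cite: MumfordAV1970, §13 Theorem (p. 125) and its proof]
[cite: MumfordAV1970, §7 Thm. 4 (p. 72) and Remark p. 69] [cite: MumfordFogartyKirwan1994, Ch. 6 §1 Corollary 6.8 (p. 118) and §2 (p. 121)] -/
theorem exists_quotient_poincare_of_constant_sections {S' : Scheme.{u}} [IsAffine S'] [IsLocallyNoetherian S']
    {k : Type u} [Field k] [CharZero k] (hk : S' ⟶ Spec (.of k))
    (A' : AbelianSchemeOver S') (hA' : Morphisms.IsProjective A'.X.hom) {L' : A'.left.Modules} (hL' : HasRank L' 1)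
    (hε' : CechPic.pullback A'.unitSection (detClass (HasRank.isFiniteLocallyFree' hL')) = 1)
    (K' : Subgroup A'.Sections) [Finite K']
    (hKinj : ∀ (Ω : Type u) [Field Ω] [IsAlgClosed Ω] (s : Spec (.of Ω) ⟶ S') (σ : A'.Sections), σ ∈ K' → σ ≠ 1 →
      A'.restrict s σ ≠ A'.restrict s 1)
    (hKL : ∀ σ : K', A'.MemKOfL L' (σ : A'.Sections)) :
    ∃ (hat : AbelianSchemeOver S') (π : A'.X ⟶ hat.X) (_ : IsMonHom π) (_ : IsFinite π.left) (_ : Etale π.left)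
      (_ : Surjective π.left) (P : (A'.prodLeft hat).Modules),
      (∀ (T : Over S') (x : T ⟶ A'.X), x ≫ π = 1 ↔
        ∃ 𝒱 : Scheme.OpenCover.{u} T.left, ∀ j, ∃ σ : K', 𝒱.f j ≫ x.left = 𝒱.f j ≫ T.hom ≫ (σ : A'.Sections).left) ∧
      HasRank P 1 ∧
      Nonempty ((Scheme.Modules.pullback (A'.unitSlice hat)).obj P ≅ SheafOfModules.unit _) ∧
      (∀ (Ω : Type u) [Field Ω] [IsAlgClosed Ω] (b : Spec (.of Ω) ⟶ hat.X.left),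
        IsHomogeneous (A'.fibre (b ≫ hat.X.hom)).toAbelianVariety ((Scheme.Modules.pullback (A'.fibreSlice hat b)).obj P)) ∧
      Nonempty ((Scheme.Modules.pullback (A'.X ◁ π).left).obj P ≅ A'.mumfordBundle L') ∧
      (∀ F : Finset hat.X.left, ∃ U : hat.X.left.Opens, IsAffineOpen U ∧ ∀ x ∈ F, x ∈ U) := by
  haveI : IsCommMonObj A'.X := A'.isCommMonObj_of_isLocallyNoetherian_base
  haveI := A'.isProper
  haveI : IsSeparated (A'.X.hom ≫ 𝟙 S') := by rw [Category.comp_id]; infer_instance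
  haveI : LocallyOfFiniteType (A'.X.hom ≫ 𝟙 S') := by rw [Category.comp_id]; infer_instance
  -- the four raw hypotheses of ★ `quotientBy`, discharged
  have hfinA : ∀ s : Finset A'.left, ∃ U : A'.left.Opens, IsAffineOpen U ∧ ∀ x ∈ s, x ∈ U := fun s =>
    Morphisms.exists_isAffineOpen_forall_mem_of_isProjective hA' s
  have hcov := A'.translationActionOver_hcov_of_forall_finset (𝟙 S') K' hfinA
  have hfree := A'.forall_comp_translation_ne_of_forall_restrict_ne K' hKinj
  have hG := A'.exists_grpObj_isMonHom_quotientMk (𝟙 S') K' hcov hfree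
  have hsm := A'.smooth_quotientOver_hom_of_hom_spec (𝟙 S') K' hcov hk hfree
  have hgc := A'.geometricallyConnected_quotientOver_hom (𝟙 S') K' hcov
  -- the normalised linearisation of `Λ(L′)` and the rigidified descent
  obtain ⟨Φ⟩ := A'.nonempty_equivariantStructure_mumfordBundle (𝟙 S') K' hcov hL' hε' hKL
  obtain ⟨P, hP1, hrig, hpic, hsock⟩ := A'.exists_rigidified_descent_mumfordBundle (𝟙 S') K' hcov hG hsm hgc hfree hL' hε' Φ
  exact ⟨A'.quotientBy (𝟙 S') K' hcov hG hsm hgc,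
    (show A'.X ⟶ (A'.quotientBy (𝟙 S') K' hcov hG hsm hgc).X from A'.quotientMk (𝟙 S') K' hcov),
    A'.isMonHom_quotientMk (𝟙 S') K' hcov hG hsm hgc, A'.isFinite_quotientMk_left (𝟙 S') K' hcov,
    A'.etale_quotientMk_left (𝟙 S') K' hcov hfree, ⟨A'.quotientMk_left_surjective (𝟙 S') K' hcov⟩, P,
    fun T x => A'.comp_quotientMk_eq_one_iff_exists_openCover (𝟙 S') K' hcov hG hsm hgc hfree x,
    hP1, hrig, hpic, hsock, A'.exists_isAffineOpen_forall_mem_quotientOver (𝟙 S') K' hcov hfinA⟩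

/-! ## §2 The base-changed situation `A′ = A ×_{S} S′`, `L′ = L|_{A′}`, `K(L′)` constant on `K′` (letter (Mb) shape) -/

/-- Rigidification is stable under base change: `ε_{S′}^*[L|_{A′}] = 1` when `ε^*[L] = 1` (`ε_{S′} ≫ pr = p ≫ ε`, ★
`unitSection_baseChange_comp_fst`). [cite: MumfordFogartyKirwan1994, Ch. 6 §2 (p. 121)] -/
theorem pullback_unitSection_detClass_baseChange_eq_one {S S' : Scheme.{u}} (A : AbelianSchemeOver S) (p : S' ⟶ S)
    {L : A.left.Modules} (hL : HasRank L 1)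
    (hε : CechPic.pullback A.unitSection (detClass (HasRank.isFiniteLocallyFree' hL)) = 1) :
    CechPic.pullback (A.baseChange p).unitSection
      (detClass (HasRank.isFiniteLocallyFree' (hasRank_pullback (pullback.fst A.X.hom p) hL))) = 1 := by
  have hd : detClass (HasRank.isFiniteLocallyFree' (hasRank_pullback (pullback.fst A.X.hom p) hL)) =
      CechPic.pullback (pullback.fst A.X.hom p) (detClass (HasRank.isFiniteLocallyFree' hL)) :=
    detClass_pullback _ _
  rw [hd]
  calc CechPic.pullback (A.baseChange p).unitSection
        (CechPic.pullback (pullback.fst A.X.hom p) (detClass (HasRank.isFiniteLocallyFree' hL)))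
      = CechPic.pullback ((A.baseChange p).unitSection ≫ pullback.fst A.X.hom p)
          (detClass (HasRank.isFiniteLocallyFree' hL)) := (CechPic.pullback_comp _ _ _).symm
    _ = 1 := by rw [A.unitSection_baseChange_comp_fst p, CechPic.pullback_comp, hε, map_one]

/-- **MUMFORD'S CONSTRUCTION IN THE BASE-CHANGED SITUATION `A′ = A ×_S S′`, `L′ = L|_{A′}`, `K(L′)` CONSTANT** — the letter
(Mb) of the F-3 (M) child line up to universe: for `A → S` with a rigidified rank-one `L`, `p : S′ → S` with `S′` affine locally
Noetherian of characteristic `0`, `A′ := A ×_S S′` projective over `S′`, and a finite `K′ ≤ A′(S′)`, pairwise distinct on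
geometric fibres, on which `K(L′)` is the constant functor («`u ∈ K(L′)(T)` iff `u` is locally a section of `K′`»): the
conclusion of §1 with the kernel clause returned in `K(L′)` form. [cite: MumfordAV1970, §13 Theorem (p. 125) and its proof]
[cite: MumfordFogartyKirwan1994, Ch. 6 §1 Corollary 6.8 (p. 118) and §2 (p. 121)] [cite: MilneAV2008, I §8 pp. 36–37] -/
theorem exists_quotient_poincare_of_constant_kOfL_baseChange {S S' : Scheme.{u}} [IsAffine S'] [IsLocallyNoetherian S']
    {k : Type u} [Field k] [CharZero k] (hk : S' ⟶ Spec (.of k))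
    (A : AbelianSchemeOver S) {L : A.left.Modules} (hL : HasRank L 1)
    (hε : CechPic.pullback A.unitSection (detClass (HasRank.isFiniteLocallyFree' hL)) = 1)
    (p : S' ⟶ S) (hA' : Morphisms.IsProjective (A.baseChange p).X.hom)
    (K' : Subgroup (A.baseChange p).Sections) [Finite K']
    (hKinj : ∀ (Ω : Type u) [Field Ω] [IsAlgClosed Ω] (s : Spec (.of Ω) ⟶ S') (σ : (A.baseChange p).Sections),
      σ ∈ K' → σ ≠ 1 → (A.baseChange p).restrict s σ ≠ (A.baseChange p).restrict s 1)
    (hK' : ∀ (T : Over S') (u : T ⟶ (A.baseChange p).X),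
      (A.baseChange p).MemKOfL ((Scheme.Modules.pullback (pullback.fst A.X.hom p)).obj L) u ↔
        ∃ 𝒱 : Scheme.OpenCover.{u} T.left, ∀ j, ∃ σ : K',
          𝒱.f j ≫ u.left = 𝒱.f j ≫ T.hom ≫ (σ : (A.baseChange p).Sections).left) :
    ∃ (hat : AbelianSchemeOver S') (π : (A.baseChange p).X ⟶ hat.X) (_ : IsMonHom π)
      (_ : IsFinite π.left) (_ : Etale π.left) (_ : Surjective π.left)
      (P : ((A.baseChange p).prodLeft hat).Modules),
      (∀ (T : Over S') (u : T ⟶ (A.baseChange p).X),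
        u ≫ π = 1 ↔ (A.baseChange p).MemKOfL ((Scheme.Modules.pullback (pullback.fst A.X.hom p)).obj L) u) ∧
      HasRank P 1 ∧
      Nonempty ((Scheme.Modules.pullback ((A.baseChange p).unitSlice hat)).obj P ≅ SheafOfModules.unit _) ∧
      (∀ (Ω : Type u) [Field Ω] [IsAlgClosed Ω] (b : Spec (.of Ω) ⟶ hat.X.left),
        IsHomogeneous ((A.baseChange p).fibre (b ≫ hat.X.hom)).toAbelianVariety
          ((Scheme.Modules.pullback ((A.baseChange p).fibreSlice hat b)).obj P)) ∧
      Nonempty ((Scheme.Modules.pullback ((A.baseChange p).X ◁ π).left).obj P ≅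
        (A.baseChange p).mumfordBundle ((Scheme.Modules.pullback (pullback.fst A.X.hom p)).obj L)) ∧
      (∀ F : Finset hat.X.left, ∃ U : hat.X.left.Opens, IsAffineOpen U ∧ ∀ x ∈ F, x ∈ U) := by
  -- `K′ ⊆ K(L′)(S′)`: a section IS locally (indeed globally) a section of `K′`
  have hKL : ∀ σ : K', (A.baseChange p).MemKOfL ((Scheme.Modules.pullback (pullback.fst A.X.hom p)).obj L)
      (σ : (A.baseChange p).Sections) := fun σ =>
    (hK' _ _).2 ⟨(𝟙_ (Over S')).left.affineCover, fun j => ⟨σ, by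
      rw [show (𝟙_ (Over S')).hom ≫ ((σ : (A.baseChange p).Sections)).left = (σ : (A.baseChange p).Sections).left from
        Category.id_comp _]⟩⟩
  obtain ⟨hat, π, hπ, hfin, het, hsurj, P, hker, h1, h2, h3, h4, h5⟩ :=
    (A.baseChange p).exists_quotient_poincare_of_constant_sections hk hA' (hasRank_pullback (pullback.fst A.X.hom p) hL)
      (A.pullback_unitSection_detClass_baseChange_eq_one p hL hε) K' hKinj hKL
  exact ⟨hat, π, hπ, hfin, het, hsurj, P, fun T u => (hker T u).trans (hK' T u).symm, h1, h2, h3, h4, h5⟩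

end AbelianSchemeOver

end Literature.AlgebraicGeometry.AbelianSchemes

end
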